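import Literature.Probability.RandomPlanarGeometry.HexSAW
import Literature.Probability.LatticeModels.TriangularLatticeProofs
import Mathlib.Analysis.Subadditive
import Mathlib.Analysis.SpecialFunctions.Pow.Real
import HarnessLib

/-!
# Self-avoiding walks on the hexagonal lattice: combinatorial groundwork

Topic `Literature/Probability/RandomPlanarGeometry`; support for the discharge of the named fact
`Literature.Probability.RandomPlanarGeometry.SAW.DuminilCopinSmirnov2012_thm1` (`HexSAW.lean`): H. Duminil-Copin, S. Smirnov, *The
connective constant of the honeycomb lattice equals `√(2+√2)`*, Ann. of Math. 175 (2012),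
1653–1665 (arXiv:1007.0575), §1: "`c_{n+m} ≤ cₙ c_m`, from which it follows that there exists
`μ ∈ (0, +∞)` such that `μ := lim cₙ^{1/n}`".

## Contents

* `hexGraph_adj_iff_coord`: the adjacency of `hexGraph` (`TriangularLattice.lean`) in
  coordinates, assembled from the two adjacency facts proved in `TriangularLatticeProofs.lean`
  (`hexGraph_adj_iff_of_snd_eq_zero_holds`: the up triangle `(x, 0)` is adjacent exactly to the
  down triangles `(x, 1)`, `(x - e₀, 1)`, `(x - e₁, 1)`; `not_hexGraph_adj_of_snd_eq_holds`).
* `HV := ℤ × ℤ × Bool`, `hvGraph`: a coordinate model of the honeycomb lattice with the graph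
  isomorphism `hvIso : hexGraph ≃g hvGraph` (`(x, i) ↦ (x 0, x 1, i = 1)`), its automorphisms
  `HV.shift` (translations by `ℤ²`) and `HV.flip` (`(x₀, x₁, b) ↦ (-x₀, -x₁-1, ¬ b)`), whence
  vertex transitivity (`HV.toOrigin`, `card_sawFin_eq`).
* `sawLists G v n` (self-avoiding walks as vertex lists) with `sawCount_eq_ncard_sawLists`
  (generic), the explicit finset `HV.sawFin` and `hexSawCount_eq_card : cₙ(ℍ) = #(sawFin O n)`.
* `hexSawCount_add_le : c_{m+n} ≤ c_m c_n`, `hexSawCount_pos : 0 < cₙ` (vertical zigzag),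
  `hexConnectiveConstant` (`μ := exp (lim (log cₙ)/n)`, Fekete via Mathlib's `Subadditive`),
  `hexConnectiveConstant_pow_le : μⁿ ≤ cₙ`, `tendsto_hexSawCount_rpow : cₙ^{1/n} → μ`,
  `hexConnectiveConstant_eq_of_thm1` (the named fact `DuminilCopinSmirnov2012_thm1` says
  `μ = √(2+√2)`).

## Design

All later combinatorics (strip domains, parafermionic observable, bridges) is done in the model
`HV`, where coordinates are plain integers; only `cₙ` is transported, through lists
(`sawCount_iso`), which avoids dependent-type transport of `SimpleGraph.Walk`.
-/

noncomputable section

open Finset Literature.Probability.LatticeModels Literature.Probability.Percolation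

namespace Literature.Probability.RandomPlanarGeometry.SAW

/-! ### Explicit adjacency of `hexGraph` -/

/-- Two sites of `ℤ²` are equal iff their two coordinates agree (a local copy of the
two-coordinate extensionality also stated in non-importable assembly files). [folklore] -/
theorem site_two_eq_iff (p q : Site 2) : p = q ↔ p 0 = q 0 ∧ p 1 = q 1 := by
  constructor
  · rintro rfl; exact ⟨rfl, rfl⟩
  · intro h; funext j; fin_cases j <;> simp [h.1, h.2]

/-- Adjacency in the hexagonal lattice in coordinates: the up triangle `(x, 0)` is adjacent
exactly to the down triangles `(x, 1)`, `(x - e₀, 1)`, `(x - e₁, 1)`, and two faces of the same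
type are never adjacent — assembled from `hexGraph_adj_iff_of_snd_eq_zero_holds` and
`not_hexGraph_adj_of_snd_eq_holds` of `TriangularLatticeProofs.lean`. [folklore] -/
theorem hexGraph_adj_iff_coord (x y : Site 2) (i j : Fin 2) :
    hexGraph.Adj (x, i) (y, j) ↔
      (i = 0 ∧ j = 1 ∧ ((y 0 = x 0 ∧ y 1 = x 1) ∨ (y 0 = x 0 - 1 ∧ y 1 = x 1) ∨
        (y 0 = x 0 ∧ y 1 = x 1 - 1))) ∨
      (i = 1 ∧ j = 0 ∧ ((x 0 = y 0 ∧ x 1 = y 1) ∨ (x 0 = y 0 - 1 ∧ x 1 = y 1) ∨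
        (x 0 = y 0 ∧ x 1 = y 1 - 1))) := by
  have h0 := hexGraph_adj_iff_of_snd_eq_zero_holds
  have h2 := not_hexGraph_adj_of_snd_eq_holds
  have key : ∀ x y : Site 2, (y = x ∨ y = x - Pi.single 0 1 ∨ y = x - Pi.single 1 1) ↔
      ((y 0 = x 0 ∧ y 1 = x 1) ∨ (y 0 = x 0 - 1 ∧ y 1 = x 1) ∨ (y 0 = x 0 ∧ y 1 = x 1 - 1)) := by
    intro x y
    simp [site_two_eq_iff, Pi.sub_apply]
  fin_cases i <;> fin_cases j
  · simpa using h2 (x, 0) (y, 0) rfl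
  · simpa using (h0 x y).trans (key x y)
  · simpa [hexGraph.adj_comm] using (h0 y x).trans (key y x)
  · simpa using h2 (x, 1) (y, 1) rfl

/-! ### A coordinate model of the honeycomb lattice -/

/-- Coordinate model of the vertices of the hexagonal lattice: `(x₀, x₁, b)` stands for the face
`(![x₀, x₁], b)` of `𝕋` (`b = false`: up triangle, type `0`; `b = true`: down triangle, type `1`).
[folklore] -/
abbrev HV : Type := ℤ × ℤ × Bool

namespace HV

/-- The three neighbours of a vertex of the honeycomb lattice, in coordinates (up triangle
`(x, 0)`: the down triangles of the cells `x`, `x - e₀`, `x - e₁`; symmetrically for down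
triangles). [folklore] -/
def nbrs : HV → List HV
  | (x0, x1, false) => [(x0, x1, true), (x0 - 1, x1, true), (x0, x1 - 1, true)]
  | (x0, x1, true) => [(x0, x1, false), (x0 + 1, x1, false), (x0, x1 + 1, false)]

/-- The adjacency relation of the coordinate model, as an arithmetic statement. [folklore] -/
def AdjRel (u v : HV) : Prop :=
  (u.2.2 = false ∧ v.2.2 = true ∧ ((v.1 = u.1 ∧ v.2.1 = u.2.1) ∨ (v.1 = u.1 - 1 ∧ v.2.1 = u.2.1) ∨
    (v.1 = u.1 ∧ v.2.1 = u.2.1 - 1))) ∨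
  (u.2.2 = true ∧ v.2.2 = false ∧ ((v.1 = u.1 ∧ v.2.1 = u.2.1) ∨ (v.1 = u.1 + 1 ∧ v.2.1 = u.2.1) ∨
    (v.1 = u.1 ∧ v.2.1 = u.2.1 + 1)))

/-- The neighbour list realises the arithmetic adjacency relation. [folklore] -/
theorem mem_nbrs_iff (u v : HV) : v ∈ nbrs u ↔ AdjRel u v := by
  obtain ⟨a, b, c⟩ := u
  obtain ⟨a', b', c'⟩ := v
  cases c <;> cases c' <;> simp [nbrs, AdjRel]

/-- The adjacency relation is symmetric. [folklore] -/
theorem adjRel_symm {u v : HV} (h : AdjRel u v) : AdjRel v u := by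
  obtain ⟨a, b, c⟩ := u
  obtain ⟨a', b', c'⟩ := v
  cases c <;> cases c' <;> simp [AdjRel] at h ⊢ <;> omega

/-- The adjacency relation is irreflexive. [folklore] -/
theorem adjRel_irrefl (u : HV) : ¬ AdjRel u u := by
  obtain ⟨a, b, c⟩ := u
  cases c <;> simp [AdjRel]

end HV

/-- The honeycomb lattice in coordinates. [folklore] -/
def hvGraph : SimpleGraph HV where
  Adj := HV.AdjRel
  symm := ⟨fun _ _ h => HV.adjRel_symm h⟩
  loopless := ⟨fun u h => HV.adjRel_irrefl u h⟩

/-- Adjacency in `hvGraph`, unfolded. [folklore] -/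
theorem hvGraph_adj (u v : HV) : hvGraph.Adj u v ↔ HV.AdjRel u v := Iff.rfl

/-- Adjacency in `hvGraph` is membership in the explicit neighbour list. [folklore] -/
theorem hvGraph_adj_iff_mem_nbrs (u v : HV) : hvGraph.Adj u v ↔ v ∈ HV.nbrs u :=
  (HV.mem_nbrs_iff u v).symm

/-- Adjacency in the coordinate model is decidable. [folklore] -/
instance : DecidableRel hvGraph.Adj := fun u v =>
  decidable_of_iff _ (hvGraph_adj_iff_mem_nbrs u v).symm

/-- From `HexVertex` to coordinates. [folklore] -/
def toHV (f : HexVertex) : HV := (f.1 0, f.1 1, decide (f.2 = 1))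

/-- From coordinates to `HexVertex`. [folklore] -/
def ofHV (v : HV) : HexVertex := (![v.1, v.2.1], if v.2.2 then 1 else 0)

/-- `toHV` is a left inverse of `ofHV`. [folklore] -/
@[simp] theorem toHV_ofHV (v : HV) : toHV (ofHV v) = v := by
  obtain ⟨a, b, c⟩ := v
  cases c <;> simp [toHV, ofHV]

/-- `ofHV` is a left inverse of `toHV`. [folklore] -/
@[simp] theorem ofHV_toHV (f : HexVertex) : ofHV (toHV f) = f := by
  obtain ⟨x, i⟩ := f
  refine Prod.ext ?_ ?_
  · funext j; fin_cases j <;> simp [toHV, ofHV]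
  · fin_cases i <;> simp [toHV, ofHV]

/-- `HexVertex ≃ HV`. [folklore] -/
def hvEquiv : HexVertex ≃ HV where
  toFun := toHV
  invFun := ofHV
  left_inv := ofHV_toHV
  right_inv := toHV_ofHV

/-- `hvEquiv` is `toHV`. [folklore] -/
@[simp] theorem hvEquiv_apply (f : HexVertex) : hvEquiv f = toHV f := rfl

/-- First coordinate of `toHV`. [folklore] -/
@[simp] theorem toHV_fst (x : Site 2) (i : Fin 2) : (toHV (x, i)).1 = x 0 := rfl
/-- Second coordinate of `toHV`. [folklore] -/
@[simp] theorem toHV_snd_fst (x : Site 2) (i : Fin 2) : (toHV (x, i)).2.1 = x 1 := rfl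
/-- Type of `toHV`. [folklore] -/
@[simp] theorem toHV_snd_snd (x : Site 2) (i : Fin 2) : (toHV (x, i)).2.2 = decide (i = 1) := rfl

/-- The coordinate map is a graph isomorphism `hexGraph ≃g hvGraph`. [folklore] -/
theorem hexGraph_adj_iff_hvGraph_adj (f g : HexVertex) :
    hexGraph.Adj f g ↔ hvGraph.Adj (toHV f) (toHV g) := by
  obtain ⟨x, i⟩ := f
  obtain ⟨y, j⟩ := g
  rw [hexGraph_adj_iff_coord, hvGraph_adj, HV.AdjRel]
  fin_cases i <;> fin_cases j <;> simp
  omega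

/-- The graph isomorphism between `hexGraph` and its coordinate model. [folklore] -/
def hvIso : hexGraph ≃g hvGraph where
  toEquiv := hvEquiv
  map_rel_iff' := fun {f g} => (hexGraph_adj_iff_hvGraph_adj f g).symm

/-- The base vertex of `hexSawCount` in coordinates. [folklore] -/
def hvOrigin : HV := (0, 0, false)

/-- The base vertex `((0 : Site 2), 0)` is the origin of the model. [folklore] -/
@[simp] theorem toHV_origin : toHV ((0 : Site 2), (0 : Fin 2)) = hvOrigin := rfl


/-! ### Self-avoiding walks as vertex lists -/

section Lists

variable {V W : Type*} (G : SimpleGraph V) (G' : SimpleGraph W)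

/-- The `n`-step self-avoiding walks from `v`, as vertex lists: chains of adjacent vertices of
length `n + 1` starting at `v` without repetition. [folklore] -/
def sawLists (v : V) (n : ℕ) : Set (List V) :=
  {l | l.IsChain G.Adj ∧ l.head? = some v ∧ l.length = n + 1 ∧ l.Nodup}

variable {G} in
/-- Membership in `sawLists`, unfolded. [folklore] -/
theorem mem_sawLists_iff {v : V} {n : ℕ} {l : List V} :
    l ∈ sawLists G v n ↔ l.IsChain G.Adj ∧ l.head? = some v ∧ l.length = n + 1 ∧ l.Nodup :=
  Iff.rfl

/-- `sawCount` counts self-avoiding vertex lists (a walk is determined by its support).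
[folklore] -/
theorem sawCount_eq_ncard_sawLists (v : V) (n : ℕ) :
    sawCount G v n = (sawLists G v n).ncard := by
  unfold sawCount
  refine Set.ncard_congr (fun p _ => p.2.support) ?_ ?_ ?_
  · rintro ⟨w, p⟩ ⟨hl, hp⟩
    refine ⟨p.isChain_adj_support, by rw [← p.cons_tail_support]; rfl, by
      rw [SimpleGraph.Walk.length_support, hl], (SimpleGraph.Walk.isPath_def p).1 hp⟩
  · rintro ⟨w, p⟩ ⟨w', p'⟩ _ _ h
    dsimp only at h
    obtain rfl : w = w' := by
      rw [← p.getLast_support, ← p'.getLast_support]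
      exact List.getLast_congr _ _ h
    obtain rfl := SimpleGraph.Walk.ext_support h
    rfl
  · rintro l ⟨hc, hh, hl, hn⟩
    have hne : l ≠ [] := by rintro rfl; simp at hl
    have hv : l.head hne = v := by
      rw [List.head?_eq_some_head hne, Option.some_inj] at hh; exact hh
    refine ⟨⟨l.getLast hne, (SimpleGraph.Walk.ofSupport l hne hc).copy hv rfl⟩, ⟨?_, ?_⟩, ?_⟩
    · rw [SimpleGraph.Walk.length_copy, SimpleGraph.Walk.length_ofSupport, hl]; rfl
    · rw [SimpleGraph.Walk.isPath_def, SimpleGraph.Walk.support_copy,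
        SimpleGraph.Walk.support_ofSupport]; exact hn
    · simp [SimpleGraph.Walk.support_copy, SimpleGraph.Walk.support_ofSupport]

variable {G G'} in
/-- Self-avoiding lists are transported by a graph isomorphism. [folklore] -/
theorem map_mem_sawLists_iff (φ : G ≃g G') {v : V} {n : ℕ} {l : List V} :
    l.map φ ∈ sawLists G' (φ v) n ↔ l ∈ sawLists G v n := by
  simp only [mem_sawLists_iff, List.head?_map, Option.map_eq_some_iff, List.length_map,
    List.nodup_map_iff φ.injective, List.isChain_map]
  constructor
  · rintro ⟨hc, ⟨a, ha, hav⟩, hl, hn⟩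
    refine ⟨?_, ?_, hl, hn⟩
    · exact List.IsChain.imp (fun a b h => (φ.map_rel_iff).1 h) hc
    · rw [ha, φ.injective hav]
  · rintro ⟨hc, hh, hl, hn⟩
    exact ⟨List.IsChain.imp (fun a b h => (φ.map_rel_iff).2 h) hc, ⟨v, hh, rfl⟩, hl, hn⟩

variable {G G'} in
/-- A graph isomorphism preserves the number of self-avoiding walks. [folklore] -/
theorem ncard_sawLists_iso (φ : G ≃g G') (v : V) (n : ℕ) :
    (sawLists G' (φ v) n).ncard = (sawLists G v n).ncard := by
  have : sawLists G' (φ v) n = (fun l : List V => l.map φ) '' sawLists G v n := by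
    ext l'
    constructor
    · intro h
      refine ⟨l'.map φ.symm, ?_, by simp [List.map_map]⟩
      rw [← map_mem_sawLists_iff φ]
      simpa [List.map_map] using h
    · rintro ⟨l, hl, rfl⟩
      exact (map_mem_sawLists_iff φ).2 hl
  rw [this, Set.ncard_image_of_injective _ (List.map_injective_iff.2 φ.injective)]

variable {G G'} in
/-- `sawCount` is invariant under graph isomorphisms. [folklore] -/
theorem sawCount_iso (φ : G ≃g G') (v : V) (n : ℕ) :
    sawCount G' (φ v) n = sawCount G v n := by
  rw [sawCount_eq_ncard_sawLists, sawCount_eq_ncard_sawLists, ncard_sawLists_iso]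

end Lists

/-- `cₙ(ℍ)` computed in the coordinate model. [folklore] -/
theorem hexSawCount_eq_ncard (n : ℕ) : hexSawCount n = (sawLists hvGraph hvOrigin n).ncard := by
  rw [hexSawCount, ← toHV_origin, ← hvEquiv_apply, show (hvEquiv : HexVertex → HV) = hvIso from rfl,
    ← sawCount_eq_ncard_sawLists, sawCount_iso]


/-! ### Enumerating self-avoiding lists of the honeycomb lattice -/

section Enumerate

variable {α : Type*} [DecidableEq α]

/-- The lists of length `n` with entries in the finset `S`. [folklore] -/
def listsLen (S : Finset α) : ℕ → Finset (List α)
  | 0 => {[]}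
  | n + 1 => (S ×ˢ listsLen S n).image fun p => p.1 :: p.2

omit [DecidableEq α] in
/-- Membership in `listsLen`. [folklore] -/
theorem mem_listsLen_iff [DecidableEq α] {S : Finset α} {n : ℕ} {l : List α} :
    l ∈ listsLen S n ↔ l.length = n ∧ ∀ x ∈ l, x ∈ S := by
  induction n generalizing l with
  | zero => cases l <;> simp [listsLen]
  | succ n ih =>
    cases l with
    | nil => simp [listsLen]
    | cons a l =>
      simp only [listsLen, mem_image, mem_product, Prod.exists, List.cons.injEq,
        List.length_cons, Nat.add_right_cancel_iff, List.mem_cons, forall_eq_or_imp]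
      constructor
      · rintro ⟨b, l', ⟨hb, hl'⟩, rfl, rfl⟩
        exact ⟨(ih.1 hl').1, hb, (ih.1 hl').2⟩
      · rintro ⟨hl, ha, hmem⟩
        exact ⟨a, l, ⟨ha, ih.2 ⟨hl, hmem⟩⟩, rfl, rfl⟩

end Enumerate

namespace HV

/-- Adjacent vertices have coordinates differing by at most one. [folklore] -/
theorem abs_sub_le_one_of_adj {u v : HV} (h : hvGraph.Adj u v) :
    |v.1 - u.1| ≤ 1 ∧ |v.2.1 - u.2.1| ≤ 1 := by
  rw [hvGraph_adj, AdjRel] at h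
  constructor <;> rw [abs_le] <;> omega

/-- The box of vertices at sup-distance at most `n` from `v` (both types). [folklore] -/
def box (v : HV) (n : ℕ) : Finset HV :=
  Icc (v.1 - n) (v.1 + n) ×ˢ (Icc (v.2.1 - n) (v.2.1 + n) ×ˢ univ)

/-- Membership in `box`. [folklore] -/
theorem mem_box_iff {v : HV} {n : ℕ} {x : HV} :
    x ∈ box v n ↔ |x.1 - v.1| ≤ n ∧ |x.2.1 - v.2.1| ≤ n := by
  simp only [box, mem_product, mem_Icc, mem_univ, and_true, abs_le]
  omega

/-- A chain of adjacent vertices stays in the box around its head. [folklore] -/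
theorem mem_box_of_isChain :
    ∀ (l : List HV) (v : HV), (v :: l).IsChain hvGraph.Adj →
      ∀ x ∈ v :: l, x ∈ box v l.length
  | [], v, _, x, hx => by
    simp only [List.mem_singleton] at hx
    subst hx; simp [mem_box_iff]
  | w :: l, v, h, x, hx => by
    rw [List.isChain_cons_cons] at h
    rcases List.mem_cons.1 hx with rfl | hx
    · simp only [mem_box_iff, sub_self, abs_zero, List.length_cons, Nat.cast_add, Nat.cast_one,
        and_self]
      positivity
    · have hw := mem_box_of_isChain l w h.2 x hx
      have h1 := abs_sub_le_one_of_adj h.1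
      rw [mem_box_iff] at hw ⊢
      simp only [List.length_cons, Nat.cast_add, Nat.cast_one]
      constructor
      · calc |x.1 - v.1| = |(x.1 - w.1) + (w.1 - v.1)| := by ring_nf
          _ ≤ |x.1 - w.1| + |w.1 - v.1| := abs_add_le _ _
          _ ≤ l.length + 1 := by linarith [hw.1, h1.1]
      · calc |x.2.1 - v.2.1| = |(x.2.1 - w.2.1) + (w.2.1 - v.2.1)| := by ring_nf
          _ ≤ |x.2.1 - w.2.1| + |w.2.1 - v.2.1| := abs_add_le _ _
          _ ≤ l.length + 1 := by linarith [hw.2, h1.2]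

/-- The finset of `n`-step self-avoiding lists of the honeycomb lattice from `v`. [folklore] -/
def sawFin (v : HV) (n : ℕ) : Finset (List HV) :=
  (listsLen (box v n) (n + 1)).filter fun l => l.IsChain hvGraph.Adj ∧ l.head? = some v ∧ l.Nodup

/-- `sawFin` enumerates exactly the self-avoiding lists. [folklore] -/
theorem mem_sawFin_iff {v : HV} {n : ℕ} {l : List HV} :
    l ∈ sawFin v n ↔ l ∈ sawLists hvGraph v n := by
  rw [sawFin, mem_filter, mem_listsLen_iff, mem_sawLists_iff]
  constructor
  · rintro ⟨⟨hl, -⟩, hc, hh, hn⟩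
    exact ⟨hc, hh, hl, hn⟩
  · rintro ⟨hc, hh, hl, hn⟩
    refine ⟨⟨hl, ?_⟩, hc, hh, hn⟩
    cases l with
    | nil => simp at hl
    | cons w l =>
      simp only [List.head?_cons, Option.some.injEq] at hh
      subst hh
      simp only [List.length_cons, Nat.add_right_cancel_iff] at hl
      rw [← hl]
      exact mem_box_of_isChain l w hc

/-- `sawFin` as a set is `sawLists`. [folklore] -/
theorem coe_sawFin (v : HV) (n : ℕ) : (sawFin v n : Set (List HV)) = sawLists hvGraph v n :=
  Set.ext fun _ => mem_sawFin_iff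

/-- The number of self-avoiding lists is the cardinality of `sawFin`. [folklore] -/
theorem ncard_sawLists_eq_card_sawFin (v : HV) (n : ℕ) :
    (sawLists hvGraph v n).ncard = #(sawFin v n) := by
  rw [← coe_sawFin, Set.ncard_coe_finset]

/-! ### Automorphisms: translations and the central flip -/

/-- Translation by `(a, b) ∈ ℤ²` (an automorphism of the honeycomb lattice). [folklore] -/
def shift (a b : ℤ) : hvGraph ≃g hvGraph where
  toEquiv :=
    { toFun := fun v => (v.1 + a, v.2.1 + b, v.2.2)
      invFun := fun v => (v.1 - a, v.2.1 - b, v.2.2)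
      left_inv := fun v => by simp
      right_inv := fun v => by simp }
  map_rel_iff' := by
    rintro ⟨x, y, c⟩ ⟨x', y', c'⟩
    cases c <;> cases c' <;> simp [hvGraph_adj, AdjRel] <;> omega

/-- `shift` in coordinates. [folklore] -/
@[simp] theorem shift_apply (a b : ℤ) (v : HV) : shift a b v = (v.1 + a, v.2.1 + b, v.2.2) := rfl

/-- The central inversion through the midpoint of the edge below the origin,
`(x₀, x₁, b) ↦ (-x₀, -x₁ - 1, ¬b)`; it exchanges the two vertex types and reverses levels.
[folklore] -/
def flip : hvGraph ≃g hvGraph where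
  toEquiv :=
    { toFun := fun v => (-v.1, -v.2.1 - 1, !v.2.2)
      invFun := fun v => (-v.1, -v.2.1 - 1, !v.2.2)
      left_inv := fun v => by obtain ⟨a, b, c⟩ := v; simp
      right_inv := fun v => by obtain ⟨a, b, c⟩ := v; simp }
  map_rel_iff' := by
    rintro ⟨a, b, c⟩ ⟨a', b', c'⟩
    cases c <;> cases c' <;> simp [hvGraph_adj, AdjRel] <;> omega

/-- `flip` in coordinates. [folklore] -/
@[simp] theorem flip_apply (v : HV) : flip v = (-v.1, -v.2.1 - 1, !v.2.2) := rfl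

/-- An automorphism of the honeycomb lattice taking `u` to the origin `(0, 0, false)`
(the lattice is vertex transitive). [folklore] -/
def toOrigin (u : HV) : hvGraph ≃g hvGraph :=
  if u.2.2 then flip.trans (shift u.1 (u.2.1 + 1)) else shift (-u.1) (-u.2.1)

/-- `toOrigin u` maps `u` to the origin. [folklore] -/
theorem toOrigin_apply_self (u : HV) : toOrigin u u = hvOrigin := by
  obtain ⟨a, b, c⟩ := u
  cases c <;> simp [toOrigin, hvOrigin]

end HV

open HV in
/-- The number of `n`-step self-avoiding walks does not depend on the starting vertex.
[folklore] -/
theorem card_sawFin_eq (v : HV) (n : ℕ) : #(sawFin v n) = #(sawFin hvOrigin n) := by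
  rw [← ncard_sawLists_eq_card_sawFin, ← ncard_sawLists_eq_card_sawFin, ← toOrigin_apply_self v,
    ncard_sawLists_iso]

open HV in
/-- `cₙ(ℍ)` as the cardinality of an explicit finset of vertex lists. [folklore] -/
theorem hexSawCount_eq_card (n : ℕ) : hexSawCount n = #(sawFin hvOrigin n) := by
  rw [hexSawCount_eq_ncard, ncard_sawLists_eq_card_sawFin]


/-! ### Submultiplicativity and positivity of `cₙ` -/

namespace HV

/-- Splitting map for `c_{m+n} ≤ c_m c_n`: the first `m` steps, and the last `n` steps moved to
the origin by the automorphism `toOrigin` of the `m`-th vertex.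
[cite: DuminilCopinSmirnov2012, §1] -/
def splitSAW (m : ℕ) (l : List HV) : List HV × List HV :=
  (l.take (m + 1), (l.drop m).map (toOrigin (l.getD m hvOrigin)))

/-- The two pieces of a split self-avoiding walk are self-avoiding walks from the origin.
[cite: DuminilCopinSmirnov2012, §1] -/
theorem splitSAW_mem {m n : ℕ} {l : List HV} (hl : l ∈ sawLists hvGraph hvOrigin (m + n)) :
    (splitSAW m l).1 ∈ sawLists hvGraph hvOrigin m ∧
      (splitSAW m l).2 ∈ sawLists hvGraph hvOrigin n := by
  obtain ⟨hc, hh, hlen, hnd⟩ := hl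
  have hm : m < l.length := by omega
  constructor
  · refine ⟨hc.take _, ?_, ?_, hnd.sublist (List.take_sublist _ _)⟩
    · cases l with
      | nil => simp at hm
      | cons a l => simpa [splitSAW] using hh
    · simp only [splitSAW, List.length_take]; omega
  · have hd : (l.drop m).head? = some (l.getD m hvOrigin) := by
      rw [List.head?_drop, List.getD_eq_getElem?_getD, List.getElem?_eq_getElem hm]
      rfl
    have h2 : l.drop m ∈ sawLists hvGraph (l.getD m hvOrigin) n :=
      ⟨hc.drop _, hd, by simp only [List.length_drop]; omega, hnd.sublist (List.drop_sublist _ _)⟩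
    have := (map_mem_sawLists_iff (toOrigin (l.getD m hvOrigin)) (l := l.drop m) (n := n)
      (v := l.getD m hvOrigin)).2 h2
    rwa [toOrigin_apply_self] at this

/-- Splitting is injective ("uniquely cut"). [cite: DuminilCopinSmirnov2012, §1] -/
theorem splitSAW_injOn (m n : ℕ) :
    Set.InjOn (splitSAW m) (sawLists hvGraph hvOrigin (m + n)) := by
  intro l hl l' hl' h
  simp only [splitSAW, Prod.mk.injEq] at h
  obtain ⟨h1, h2⟩ := h
  have hm : m < l.length := by have := hl.2.2.1; omega
  have hm' : m < l'.length := by have := hl'.2.2.1; omega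
  have hget : l.getD m hvOrigin = l'.getD m hvOrigin := by
    have e1 : (l.take (m + 1))[m]? = l[m]? := by
      rw [List.getElem?_take]; simp
    have e2 : (l'.take (m + 1))[m]? = l'[m]? := by
      rw [List.getElem?_take]; simp
    rw [List.getD_eq_getElem?_getD, List.getD_eq_getElem?_getD, ← e1, ← e2, h1]
  rw [hget] at h2
  have h3 : l.drop m = l'.drop m := List.map_injective_iff.2 (RelIso.injective _) h2
  have h4 : l.take m = l'.take m := by
    have := congrArg (List.take m) h1
    rwa [List.take_take, List.take_take, min_eq_left (Nat.le_succ m)] at this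
  rw [← List.take_append_drop m l, ← List.take_append_drop m l', h3, h4]

end HV

open HV in
/-- **Submultiplicativity** `c_{m+n} ≤ c_m c_n`: "an `(n+m)`-step self-avoiding walk can be
uniquely cut into an `n`-step self-avoiding walk and a parallel translation of an `m`-step
self-avoiding walk" (up to an automorphism of `ℍ`, which has two vertex classes under
translations). [cite: DuminilCopinSmirnov2012, §1] -/
theorem hexSawCount_add_le (m n : ℕ) : hexSawCount (m + n) ≤ hexSawCount m * hexSawCount n := by
  rw [hexSawCount_eq_card, hexSawCount_eq_card, hexSawCount_eq_card, ← card_product]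
  refine Finset.card_le_card_of_injOn (splitSAW m) ?_ ?_
  · intro l hl
    rw [mem_coe, mem_sawFin_iff] at hl
    rw [mem_coe, mem_product, mem_sawFin_iff, mem_sawFin_iff]
    exact splitSAW_mem hl
  · rw [coe_sawFin]
    exact splitSAW_injOn m n

namespace HV

/-- The vertical zigzag `(0, ⌊k/2⌋, k odd)`, `k = 0, 1, 2, …`, an infinite self-avoiding path of
`ℍ` climbing one level per step. [folklore] -/
def zig (k : ℕ) : HV := (0, (k / 2 : ℕ), decide (k % 2 = 1))

/-- Consecutive zigzag vertices are adjacent. [folklore] -/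
theorem zig_adj (k : ℕ) : hvGraph.Adj (zig k) (zig (k + 1)) := by
  rw [hvGraph_adj, AdjRel]
  rcases Nat.even_or_odd k with ⟨j, rfl⟩ | ⟨j, rfl⟩
  · have h1 : ¬ (j + j) % 2 = 1 := by omega
    have h2 : (j + j + 1) % 2 = 1 := by omega
    have h3 : ((j + j) / 2 : ℕ) = j := by omega
    have h4 : ((j + j + 1) / 2 : ℕ) = j := by omega
    simp [zig, h1, h2, h3, h4]
  · have h1 : (2 * j + 1) % 2 = 1 := by omega
    have h2 : ¬ (2 * j + 1 + 1) % 2 = 1 := by omega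
    have h3 : ((2 * j + 1) / 2 : ℕ) = j := by omega
    have h4 : ((2 * j + 1 + 1) / 2 : ℕ) = j + 1 := by omega
    simp [zig, h1, h2, h3, h4]

/-- The zigzag never returns. [folklore] -/
theorem zig_injective : Function.Injective zig := by
  intro a b h
  simp only [zig, Prod.mk.injEq, Nat.cast_inj, decide_eq_decide] at h
  omega

/-- The first `n` steps of the zigzag form an `n`-step self-avoiding walk. [folklore] -/
theorem zig_mem_sawLists (n : ℕ) : (List.range (n + 1)).map zig ∈ sawLists hvGraph hvOrigin n := by
  refine ⟨?_, ?_, by simp, (List.nodup_range).map zig_injective⟩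
  · rw [List.isChain_map, List.isChain_range_succ]
    intro m _
    exact zig_adj m
  · rw [List.range_succ_eq_map]; rfl

end HV

open HV in
/-- `cₙ(ℍ) ≥ 1`: the vertical zigzag is an `n`-step self-avoiding walk. [folklore] -/
theorem hexSawCount_pos (n : ℕ) : 0 < hexSawCount n := by
  rw [hexSawCount_eq_card, card_pos]
  exact ⟨_, mem_sawFin_iff.2 (zig_mem_sawLists n)⟩

/-! ### The connective constant (Fekete) -/

/-- `log cₙ` is subadditive. [cite: DuminilCopinSmirnov2012, §1] -/
theorem subadditive_log_hexSawCount : Subadditive fun n => Real.log (hexSawCount n) := by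
  intro m n
  have hm := hexSawCount_pos m
  have hn := hexSawCount_pos n
  rw [← Real.log_mul (by positivity) (by positivity)]
  apply Real.log_le_log (by exact_mod_cast hexSawCount_pos (m + n))
  exact_mod_cast hexSawCount_add_le m n

/-- **The connective constant of the hexagonal lattice**, `μ := lim cₙ^{1/n} = inf cₙ^{1/n}`
(Fekete), realised as `exp (lim (log cₙ)/n)`. [cite: DuminilCopinSmirnov2012, §1] -/
def hexConnectiveConstant : ℝ := Real.exp subadditive_log_hexSawCount.lim

/-- `μ > 0`. [cite: DuminilCopinSmirnov2012, §1] -/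
theorem hexConnectiveConstant_pos : 0 < hexConnectiveConstant := Real.exp_pos _

/-- `(log cₙ)/n ≥ 0`. [folklore] -/
private theorem bddBelow_log_div :
    BddBelow (Set.range fun n : ℕ => Real.log (hexSawCount n) / n) := by
  refine ⟨0, ?_⟩
  rintro _ ⟨n, rfl⟩
  apply div_nonneg _ (Nat.cast_nonneg n)
  apply Real.log_nonneg
  exact_mod_cast hexSawCount_pos n

/-- `μⁿ ≤ cₙ` for every `n` (`μ` is the infimum of `cₙ^{1/n}`). [cite: DuminilCopinSmirnov2012, §1] -/
theorem hexConnectiveConstant_pow_le (n : ℕ) : hexConnectiveConstant ^ n ≤ hexSawCount n := by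
  rcases Nat.eq_zero_or_pos n with rfl | hn
  · simp [hexSawCount_zero]
  have h := subadditive_log_hexSawCount.lim_le_div bddBelow_log_div hn.ne'
  rw [hexConnectiveConstant, ← Real.exp_nat_mul, ← Real.exp_log (x := (hexSawCount n : ℝ))
    (by exact_mod_cast hexSawCount_pos n)]
  apply Real.exp_le_exp.2
  rw [le_div_iff₀ (by exact_mod_cast hn)] at h
  linarith

/-- **Existence of the connective constant**: `cₙ^{1/n} → μ` (Fekete's lemma applied to the
subadditive sequence `log cₙ`). [cite: DuminilCopinSmirnov2012, §1] -/
theorem tendsto_hexSawCount_rpow :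
    Filter.Tendsto (fun n : ℕ => (hexSawCount n : ℝ) ^ (1 / (n : ℝ))) Filter.atTop
      (nhds hexConnectiveConstant) := by
  have h := subadditive_log_hexSawCount.tendsto_lim bddBelow_log_div
  have h2 := (Real.continuous_exp.tendsto _).comp h
  refine h2.congr' ?_
  filter_upwards [Filter.eventually_gt_atTop 0] with n hn
  simp only [Function.comp_apply]
  rw [Real.rpow_def_of_pos (by exact_mod_cast hexSawCount_pos n), one_div, ← div_eq_mul_inv]

/-- Coherence with the named fact of `HexSAW.lean`: Theorem 1 of Duminil-Copin–Smirnov says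
precisely that `hexConnectiveConstant = √(2+√2)`. [cite: DuminilCopinSmirnov2012, Thm 1] -/
theorem hexConnectiveConstant_eq_of_thm1 (h : DuminilCopinSmirnov2012_thm1) :
    hexConnectiveConstant = Real.sqrt (2 + Real.sqrt 2) :=
  tendsto_nhds_unique tendsto_hexSawCount_rpow h

end Literature.Probability.RandomPlanarGeometry.SAW
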